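import Summits.AtomisticToContinuum.HydrodynamicLimit.Theses.ImplosionDichotomy
import Literature.MathematicalPhysics.KineticTheory.HardSphereEulerLLN
import Summits.AtomisticToContinuum.HydrodynamicLimit.Theorems.ImplosionDichotomyPolynomialCompressionStaticsLLN
import Summits.AtomisticToContinuum.HydrodynamicLimit.Theorems.ImplosionDichotomyPolynomialCompressionStaticsSmoothRate
import Summits.AtomisticToContinuum.HydrodynamicLimit.Theorems.ImplosionDichotomyPolynomialCompressionEosRatioAnalytic
import Summits.AtomisticToContinuum.HydrodynamicLimit.Theorems.ImplosionDichotomyPolynomialCompressionEosRatioUniform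
import Summits.AtomisticToContinuum.HydrodynamicLimit.Theorems.ImplosionDichotomyPolynomialCompressionEosCesaro
import Summits.AtomisticToContinuum.HydrodynamicLimit.Theorems.ImplosionDichotomyPolynomialCompressionEosAssembly
import Summits.AtomisticToContinuum.HydrodynamicLimit.Theorems.ImplosionDichotomyPolynomialCompressionLogBudgetShadowing
import Summits.AtomisticToContinuum.HydrodynamicLimit.Theorems.ImplosionDichotomyPolynomialCompressionConditionalExistence

/-!
# Line `log-lipschitz-budget` — skeleton for the crux `ImplosionDichotomy.PolynomialCompression`
(crux item stmt-AtomisticToContinuum-12587, rank 4; route `route-AtomisticToContinuum-ImplosionDichotomy`)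

Crux (FIXED, by name): `∃ κ > 0` and continuous positive profiles `(a₀, u₀, θ₀)` such that for every `σ₀ > 0`
some `σ ∈ (0, σ₀)` admits an ADMISSIBLE classical hard-sphere–Euler solution (t = 0 fields = LLN limit of the
local Gibbs laws, every flow family) whose density reaches `σ^(−κ)` on its interval of existence.

Idea (card `Ideas/log-lipschitz-budget.md`, triage r1 k=1,2,3: pass): a smooth self-similar implosion of the
IDEAL monatomic gas (σ = 0, γ = 5/3; Cao-Labora–Gómez-Serrano–Shi–Staffilani arXiv:2310.05325 Thm 1.2 +
Rem 1.4–1.5, profiles of Buckmaster–Cao-Labora–Gómez-Serrano arXiv:2208.09445 Thm 1.1) is TYPE I: every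
quantity of dimension 1/time — `‖∇u‖∞`, `‖∇c‖∞` (c ∝ ρ^{1/3}) — is `≤ C/(T₁−t)`, so the Lipschitz budget
`∫₀^{T₁−δ} (‖∇u‖∞ + ‖∇c‖∞) dt ≤ C log(T₁/δ) + O(1)` is LOGARITHMIC and every Gronwall constant of classical
PHYSICAL-variable symmetric-hyperbolic stability theory (Kato 1975, Majda 1984 Thms 2.1–2.2) is `δ^{−O(1)}`:
the `O(σ³)` equation-of-state defect `Z(ρσ³) − 1` (Z analytic near 0: `HsEosLowDensity`) and the `O(σ³)` smooth
statics defect `ρ₀^σ − a₀/∫a₀` (tree: `rhoLim`) are amplified only POLYNOMIALLY; the admissible σ-solution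
exists classically and shadows the collapse down to `T₁ − t = σ^e`, where the reference core density
`c (T₁−t)^{−β}` dominates: `ρ_σ ≥ (c/2) σ^{−eβ} ≥ σ^{−κ}`, `κ := eβ/2`. No self-similar analysis of the forced
problem, no spectral information, no tuning (the `∃ κ`-outermost, antitone-in-κ shape of the crux is what makes
a crude polynomial loss sufficient — Disproof §3/§7).

## Stubs — STATUS (lead c2, 2026-08-16T18Z; after gen-0 cycles 1–2, the gen-1 reshape, leads c1 and c2)
* `stub_typeOneImplosion` (THE ONLY OPEN STUB; = route support item stmt-AtomisticToContinuum-15146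
  `TypeOneIdealImplosion`, signature verbatim) — σ = 0 reference: smooth positive profiles and a classical ideal-gas
  solution on `[0,T₁)` with isentropic data, Type-I gradient bounds, polynomial bounds on the derivatives of order
  `≤ 6`, polynomial lower and power-law core bounds on the density. LANDED MODULO ONE NAMED FACT:
  `Theorems.typeOneIdealImplosion_of_thm11 : BuckmasterCaolaboraGomezserrano2025_thm11_monatomic → (this signature)`
  (`…TypeOneIdealImplosion`, p109049: exact BCG self-similar core + backward exterior solution + domain of dependence
  + glue, `…TypeOneThm12Rates` p105816, Majda local well-posedness DISCHARGED in tree), and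
  `Theorems.typeOneIdealImplosion_of_leftHyp` (p116279) from the certificate layer
  `∀ r ∈ Icc Shooting.rd Shooting.ru, LeftAsm.LeftHyp r` to which the BCG fact is reduced in the Literature tree
  (`Shooting.thm11_monatomic_of_left`, `LeftAsm.leftData_of_hyp`); that layer is being discharged window by window
  by kernel certificates (Literature campaign on `BuckmasterCaolaboraGomezserrano2025_thm11_monatomic`).
* `stub_staticsLLN` + `stub_staticsSmoothRate` (LANDED p71479, p71863) ⇒ `stub_smoothStatics` proved below.
* `stub_conditionalExistence` (LANDED p106435, `Theorems.stub_conditionalExistence`, lead c1) — Kato/Majda existence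
  from a-priori bounds, via the solution API (p71557), soft continuation (p71726), uniqueness with analytic EOS
  (p74606) and the local theory `…LocalTheory`.
* `stub_logBudgetShadowing` (LANDED p115212, `Theorems.stub_logBudgetShadowing`, lead c1) — the lever: the a-priori
  log-Lipschitz-budget shadowing estimate (H³ energy method for the 5×5 hard-sphere system on `𝕋³`, ~60 helper files).
* `stub_eosRatioAnalytic`, `stub_eosRatioUniform`, `stub_eosCesaro`, `stub_eosAssembly` (E1–E3, ALL LANDED: p73064,
  p74228 (+p73032, p73763), p72929, p72629) ⇒ `hsEosLowDensity_of_stubs : HsEosLowDensity` proved below; the same glue is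
  landed as `Theorems/ImplosionDichotomyHsEosLowDensity.lean` (`hsEosLowDensity_proof`, p75216), closing route support
  stmt-AtomisticToContinuum-0768.
* `PolynomialCompression_of : PolynomialCompression` — UNCONDITIONAL composition (1 sorry left in its cone: stub 1).
  The same composition with stub 1 as a HYPOTHESIS is landed as `Theorems.polynomialCompression_of_typeOne`
  (`Theorems/ImplosionDichotomyPolynomialCompressionOfTypeOne.lean`, lead c2), together with
  `polynomialCompression_of_thm11` / `polynomialCompression_of_leftHyp`: the crux closes by one line once the BCG
  fact (or its certificate layer) is a theorem.

## Disproof used (standing `Disproof.lean`, cdisprove cycle 1 v1–v4, read through its evidence notes — the file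
under `run/gate/evidence/` is not mounted in planner/triager seats)
§1 (t = 0 tie flow-independent): the LLN clause is produced ONCE per σ (`stub_smoothStatics`) and transported to
the solution by `tendstoHydroFieldsAt_zero_of_data`. §4 (`polynomialCompressionUntied_holds`: without the tie the
crux is trivially true) and §5 (`density_zero_eq_of_lln`, `integral_density_zero_eq_one`,
`not_polynomialCompressionAtTimeZero`: data and mass are PINNED, compression must be dynamical): honoured — every
stub pins `ρ 0 = ρ₀^σ`, `u 0 = u₀`, `θ 0 = θ₀`, and the compression is read off at the exit time `T₁ − σ^e > 0`
from the reference core; no stub has the crux's `∃`-solution shape (no costume). §3 (`polynomialCompressionAt_anti`,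
ladder DE ⊢ PC for κ < 3): κ = eβ/2 is small by design; the line sits strictly below DenseExcursion. §6–§7
(`shadowing_exponent`, inputs I1–I5): I1 = `stub_typeOneImplosion`, I2 = `stub_smoothStatics` (the RATE, not
`LocalGibbsDensityLimit`'s o(1)), I3 = hypothesis `hZ`, I4 = `stub_conditionalExistence`, I5 =
`stub_logBudgetShadowing`; the exponent bookkeeping of §7 is the proved tail of `PolynomialCompression_of`.
No `_false_without_` theorem or landed `Negative/` lemma exists for this crux at planning time (2026-08-15T23Z).
-/

namespace Summit.AtomisticToContinuum.HydrodynamicLimit.Cruxes.PolynomialCompression.LogLipschitzBudget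

open Set MeasureTheory Filter
open Literature.MathematicalPhysics.KineticTheory
open Literature.Analysis.FunctionSpaces

/-! ## Stub 1 — the σ = 0 reference: a Type-I ideal-gas implosion on `𝕋³` -/

/-- STUB 1 (size XL; sources: CaolaboraEtAl2025 = arXiv:2310.05325 Thm 1.2 p.6, Rem 1.4 p.6, Rem 1.5 p.7,
profile bounds (1.6) p.6, Prop 3.3 p.25, Lemma 3.5/3.6 pp.25–26; BuckmasterCaolaboraGomezserrano2025 =
arXiv:2208.09445 Thm 1.1 (γ = 5/3 profile); the tree fact `Literature.Analysis.FluidPDE.CaolaboraEtAl2025_thm12_euler`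
is the rate-free corollary and is too weak here).
**Type-I ideal-gas implosion.** There are smooth positive profiles `(a₀, u₀, θ₀)` on `𝕋³` and a classical
solution `(ρ₁, u₁, θ₁)` of the σ = 0 (monatomic ideal gas, `p = ρθ`) system on `[0, T₁)` with data
`(a₀/∫a₀, u₀, θ₀)`, isentropic (`θ₁ = K ρ₁^{2/3}`, so `p = K ρ^{5/3}`), such that:
(Type I) `‖∂ᵢu₁(t)‖∞ + ‖∂ᵢ(ρ₁^{1/3})(t)‖∞ ≤ C/(T₁ − t)` (self-similar scaling `∂ₓ = (T−t)^{−1/r}∂_y`,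
`u = r⁻¹(T−t)^{1/r−1}U`, `ρ^{1/3} ∝ (T−t)^{1/r−1}S`, with `sup_s ‖∇_y(U,S)‖∞ < ∞`: (1.6) + p.26);
(polynomial regularity) every derivative of ORDER `n ≤ 6` of `ρ₁(t)`, `u₁(t)` is `O((T₁−t)^{−pₙ})` (gen-1 reshape:
`∀ n` → `n ≤ 6`, which is what the `H³` energy method of stub 4 consumes and what the printed CGSS bootstrap,
`E_K ≤ δ` with `K ≫ 6`, delivers; `∀ n` would need an unprinted persistence-of-regularity argument); (no vacuum) `ρ₁ ≥ c_l (T₁−t)^{p_l}` (transport + log budget); (collapse) the core density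
dominates `c (T₁ − t)^{−β}`, `β = 3(1 − 1/r) > 0` (Thm 1.2: `ρ ≍ (T−t)^{−(1−1/r)/α}`, `α = 1/3`, `S̄(0) > 0`).
Mass is normalised to 1 and the torus to period 1 by the two-parameter scaling of isentropic Euler (Rem 1.4). -/
theorem stub_typeOneImplosion :
    ∃ (a₀ θ₀ : T3 → ℝ) (u₀ : T3 → V3), Torus.IsSmooth a₀ ∧ Torus.IsSmooth θ₀ ∧ Torus.IsSmooth u₀ ∧
      (∀ x, 0 < a₀ x) ∧ (∀ x, 0 < θ₀ x) ∧
      ∃ (T₁ K : ℝ) (ρ₁ θ₁ : ℝ → T3 → ℝ) (u₁ : ℝ → T3 → V3), 0 < T₁ ∧ 0 < K ∧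
        IsHardSphereEulerSolution 0 T₁ ρ₁ u₁ θ₁ ∧
        (∀ x, ρ₁ 0 x = a₀ x / ∫ y, a₀ y) ∧ u₁ 0 = u₀ ∧ θ₁ 0 = θ₀ ∧
        (∀ t ∈ Ico 0 T₁, ∀ x, θ₁ t x = K * ρ₁ t x ^ (2 / 3 : ℝ)) ∧
        (∃ C : ℝ, ∀ t ∈ Ico 0 T₁, ∀ x, ∀ i : Fin 3,
            ‖Torus.partialDeriv i (u₁ t) x‖ ≤ C / (T₁ - t) ∧
            |Torus.partialDeriv i (fun y => ρ₁ t y ^ (1 / 3 : ℝ)) x| ≤ C / (T₁ - t)) ∧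
        (∀ n : ℕ, n ≤ 6 → ∃ Cn pn : ℝ, ∀ t ∈ Ico 0 T₁, ∀ y : EuclideanSpace ℝ (Fin 3),
            ‖iteratedFDeriv ℝ n (Torus.lift (ρ₁ t)) y‖ ≤ Cn * (T₁ - t) ^ (-pn) ∧
            ‖iteratedFDeriv ℝ n (Torus.lift (u₁ t)) y‖ ≤ Cn * (T₁ - t) ^ (-pn)) ∧
        (∃ cl pl : ℝ, 0 < cl ∧ ∀ t ∈ Ico 0 T₁, ∀ x, cl * (T₁ - t) ^ pl ≤ ρ₁ t x) ∧
        ∃ β c : ℝ, 0 < β ∧ 0 < c ∧ ∀ t ∈ Ico 0 T₁, ∃ x, c * (T₁ - t) ^ (-β) ≤ ρ₁ t x := by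
  sorry

/-! ## Stub 2 — quantitative smooth statics of the local Gibbs laws (RESHAPED by the lead into 2a + 2b) -/

/-- STUB 2a (LANDED p71479 as `Summit.AtomisticToContinuum.HydrodynamicLimit.Theorems.stub_staticsLLN`; size M; sources: tree `localGibbs_lln_holds`, `localGibbs_densityLLN_holds` (witness `rhoLim`),
`exists_smallDensity`, `SmallDensity.rhoLim_pos`, `SmallDensity.continuous_rhoLim`; the standing Disproof.lean §2
(`densityLLN_rhoLim`, `lln_rhoLim`, uniqueness of in-probability limits `eq_of_tendsto_measure_lt`) has the whole
argument, to be re-derived in a Theorems file since Cruxes/ is not importable).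
**Identified law of large numbers.** For continuous profiles `a₀, θ₀ > 0`, `u₀` there is `σ₁ > 0` such that for
`0 < σ < σ₁`: the smallness package `SmallDensity (profileOf a₀) σ` holds, the explicit cluster-series density
`rhoLim (profileOf a₀) σ` is positive, and the `t = 0` empirical density/momentum/energy fields of the local Gibbs laws
satisfy the LLN towards the constant-in-time fields `(rhoLim (profileOf a₀) σ, u₀, θ₀)` through EVERY flow family. -/
theorem stub_staticsLLN :
    ∀ (a₀ θ₀ : T3 → ℝ) (u₀ : T3 → V3) (ha : Continuous a₀), Continuous θ₀ → Continuous u₀ →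
      ∀ (ha0 : ∀ x, 0 < a₀ x), (∀ x, 0 < θ₀ x) →
      ∃ σ₁ : ℝ, 0 < σ₁ ∧ ∀ σ : ℝ, 0 < σ → σ < σ₁ →
        SmallDensity (profileOf a₀ ha ha0) σ ∧
        (∀ x, 0 < rhoLim (profileOf a₀ ha ha0) σ x) ∧
        ∀ Φ : (N : ℕ) → Literature.Analysis.FluidPDE.HardSphereFlow
            (Literature.Analysis.FluidPDE.Torus.geometry (Fin 3)) (hsDiameter σ N) (N + 1),
          TendstoHydroFieldsAt (fun N => localGibbsLaw σ a₀ u₀ θ₀ N (Φ N)) Φ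
            (fun _ => rhoLim (profileOf a₀ ha ha0) σ) (fun _ => u₀) (fun _ => θ₀) 0 := by
  exact Summit.AtomisticToContinuum.HydrodynamicLimit.Theorems.stub_staticsLLN

/-- STUB 2b (LANDED p71863 as `Summit.AtomisticToContinuum.HydrodynamicLimit.Theorems.stub_staticsSmoothRate`; size M–L; sources: tree `rhoLim` = `Σ_j clusterCoeff σ j · R^{j+1} · β^{j+1}` = `G_σ ∘ β` with
`β = a₀/∫a₀` (`profileOf_β`), `abs_clusterCoeff_le` (`|γ_{j+1}| ≤ e (e v₁ σ³)ʲ`), `SmallDensity.ratioLimit_mem`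
(`R ∈ [1/2, 2]`), `abs_ratioSeries_sub_one_le` + `ratioLimit_spec` (`|R − 1| ≤ 2eθ/(1−θ)`, `θ = geomRatio = 2eMv₁σ³`),
`coefLim_one_zero` (`γ₁ = 1`); Mathlib `norm_iteratedFDeriv_comp_le`, `FormalMultilinearSeries.ofScalars`).
**Smoothness and the `C^n` rate.** For a smooth positive activity `a₀`: whenever `SmallDensity (profileOf a₀) σ`
holds, `rhoLim (profileOf a₀) σ` is smooth on `𝕋³`, and for every `n` there is `Cₙ = Cₙ(a₀)` with
`‖Dⁿ lift(rhoLim (profileOf a₀) σ − a₀/∫a₀)(y)‖ ≤ Cₙ σ³` for all such `σ` and all `y ∈ ℝ³` (the scalar series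
`G_σ(b) − b = (R−1) b + Σ_{j≥1} γ_{j+1}R^{j+1} b^{j+1}` has all derivatives `O_n(σ³)` on `[0, M]`, radius `≥ M/θ > 6M`;
then the chain rule through the periodic lift of `β`). -/
theorem stub_staticsSmoothRate :
    ∀ (a₀ : T3 → ℝ) (ha : Torus.IsSmooth a₀) (ha0 : ∀ x, 0 < a₀ x),
      (∀ σ : ℝ, SmallDensity (profileOf a₀ ha.continuous ha0) σ →
          Torus.IsSmooth (rhoLim (profileOf a₀ ha.continuous ha0) σ)) ∧
      ∀ n : ℕ, ∃ Cn : ℝ, ∀ σ : ℝ, SmallDensity (profileOf a₀ ha.continuous ha0) σ →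
        ∀ y : EuclideanSpace ℝ (Fin 3),
          ‖iteratedFDeriv ℝ n
              (Torus.lift (fun x => rhoLim (profileOf a₀ ha.continuous ha0) σ x - a₀ x / ∫ z, a₀ z)) y‖ ≤
            Cn * σ ^ 3 := by
  exact Summit.AtomisticToContinuum.HydrodynamicLimit.Theorems.stub_staticsSmoothRate

/-- STUB 2 (now PROVED from 2a + 2b; statement unchanged from the crux-plan skeleton).
**Quantitative smooth statics.** For a smooth positive activity `a₀` and continuous `u₀`, `θ₀ > 0` there are
`σ₁ > 0` and a family `σ ↦ ρ₀^σ` such that for `0 < σ < σ₁`: `ρ₀^σ` is smooth and positive, the empirical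
density/momentum/energy fields of the local Gibbs laws at `t = 0` satisfy the LLN towards `(ρ₀^σ, u₀, θ₀)` for
EVERY flow family, and `‖ρ₀^σ − a₀/∫a₀‖_{Cⁿ} ≤ Cₙ σ³` for every `n`. Witness: `ρ₀^σ := rhoLim (profileOf a₀) σ`. -/
theorem stub_smoothStatics :
    ∀ (a₀ θ₀ : T3 → ℝ) (u₀ : T3 → V3), Torus.IsSmooth a₀ → Continuous θ₀ → Continuous u₀ →
      (∀ x, 0 < a₀ x) → (∀ x, 0 < θ₀ x) →
      ∃ σ₁ : ℝ, 0 < σ₁ ∧ ∃ ρs : ℝ → T3 → ℝ,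
        (∀ σ : ℝ, 0 < σ → σ < σ₁ →
          Torus.IsSmooth (ρs σ) ∧ (∀ x, 0 < ρs σ x) ∧
          ∀ Φ : (N : ℕ) → Literature.Analysis.FluidPDE.HardSphereFlow
              (Literature.Analysis.FluidPDE.Torus.geometry (Fin 3)) (hsDiameter σ N) (N + 1),
            TendstoHydroFieldsAt (fun N => localGibbsLaw σ a₀ u₀ θ₀ N (Φ N)) Φ
              (fun _ => ρs σ) (fun _ => u₀) (fun _ => θ₀) 0) ∧
        (∀ n : ℕ, ∃ Cn : ℝ, ∀ σ : ℝ, 0 < σ → σ < σ₁ → ∀ y : EuclideanSpace ℝ (Fin 3),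
          ‖iteratedFDeriv ℝ n (Torus.lift (fun x => ρs σ x - a₀ x / ∫ z, a₀ z)) y‖ ≤ Cn * σ ^ 3) := by
  intro a₀ θ₀ u₀ ha hθ hu ha0 hθ0
  obtain ⟨σ₁, hσ₁, H⟩ := stub_staticsLLN a₀ θ₀ u₀ ha.continuous hθ hu ha0 hθ0
  obtain ⟨hsmooth, hrate⟩ := stub_staticsSmoothRate a₀ ha ha0
  refine ⟨σ₁, hσ₁, fun σ => rhoLim (profileOf a₀ ha.continuous ha0) σ, ?_, ?_⟩
  · intro σ hσ hσ'
    obtain ⟨hsd, hpos, hlln⟩ := H σ hσ hσ'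
    exact ⟨hsmooth σ hsd, hpos, hlln⟩
  · intro n
    obtain ⟨Cn, hCn⟩ := hrate n
    exact ⟨Cn, fun σ hσ hσ' y => hCn σ (H σ hσ hσ').1 y⟩

/-! ## Stub 3 — classical existence from a-priori bounds (Kato/Majda for the hard-sphere system) -/

/-- STUB 3 (size L–XL in Lean, literature-grade on paper; sources: Kato1975 (ARMA 58) Thms I–III,
Majda1984 Thm 2.1 (local `H^m` existence, `m > 5/2`) and Thm 2.2 (continuation while `‖V‖_{C¹}` stays
bounded and `V` stays in a compact of state space), Dafermos2005 Thm 5.1.1; hyperbolicity of the 5×5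
hard-sphere system: `c² = θ[(Z + ηZ′) + (2/3)Z²] > 0` for packing `η ≤ η₁` small, `Z = 1 + η F′(η)` analytic
on `(0, η₀)` by the unbundled `HsEosLowDensity` hypotheses).
**Conditional classical existence.** Given the low-density analyticity of the hard-sphere free energy, there
is a packing threshold `η₁ > 0` such that for every `σ > 0`, all smooth data `(ρ₀ > 0, θ₀ > 0, u₀)` with
`ρ₀σ³ ≤ η₁`, every horizon `T' > 0` and constant `M`: IF every classical hard-sphere–Euler solution with these
data on any `[0,T)`, `T ≤ T'`, stays in the compact state region `{M⁻¹ ≤ ρ, θ ≤ M, |u| ≤ M, ρσ³ ≤ η₁}` with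
`|∇(ρ,u,θ)| ≤ M`, THEN a classical solution with these data exists on `[0, T')` (local well-posedness +
uniqueness + continuation criterion, packaged without a maximal-solution API; `C^∞` data give a jointly `C^∞`
solution, all `H^m` norms sharing the lifespan). -/
theorem stub_conditionalExistence :
    ∀ η₀ : ℝ, 0 < η₀ → ∀ F : ℝ → ℝ, AnalyticOnNhd ℝ F (Ioo (-η₀) η₀) →
      EqOn hsExcessFreeEnergy F (Ico 0 η₀) → F 0 = 0 → deriv F 0 = 2 * Real.pi / 3 →
      ∃ η₁ : ℝ, 0 < η₁ ∧ ∀ σ : ℝ, 0 < σ →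
        ∀ (ρ₀ θ₀ : T3 → ℝ) (u₀ : T3 → V3), Torus.IsSmooth ρ₀ → Torus.IsSmooth θ₀ → Torus.IsSmooth u₀ →
          (∀ x, 0 < ρ₀ x) → (∀ x, 0 < θ₀ x) → (∀ x, ρ₀ x * σ ^ 3 ≤ η₁) →
          ∀ T' M : ℝ, 0 < T' → 0 < M →
            (∀ T : ℝ, T ≤ T' → ∀ (ρ θ : ℝ → T3 → ℝ) (u : ℝ → T3 → V3),
                IsHardSphereEulerSolution σ T ρ u θ → ρ 0 = ρ₀ → u 0 = u₀ → θ 0 = θ₀ →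
                ∀ t ∈ Ico 0 T, ∀ x,
                  M⁻¹ ≤ ρ t x ∧ ρ t x ≤ M ∧ M⁻¹ ≤ θ t x ∧ θ t x ≤ M ∧ ‖u t x‖ ≤ M ∧
                  ρ t x * σ ^ 3 ≤ η₁ ∧
                  ∀ i : Fin 3, ‖Torus.partialDeriv i (u t) x‖ ≤ M ∧
                    |Torus.partialDeriv i (ρ t) x| ≤ M ∧ |Torus.partialDeriv i (θ t) x| ≤ M) →
            ∃ (ρ θ : ℝ → T3 → ℝ) (u : ℝ → T3 → V3),
              IsHardSphereEulerSolution σ T' ρ u θ ∧ ρ 0 = ρ₀ ∧ u 0 = u₀ ∧ θ 0 = θ₀ := by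
  exact Summit.AtomisticToContinuum.HydrodynamicLimit.Theorems.stub_conditionalExistence

/-! ## Stub 4 — the lever: the a-priori log-Lipschitz-budget shadowing estimate -/

/-- STUB 4 — HARDEST (size XL; sources: the energy method of Kato1975 / Majda1984 Thm 2.1–2.2 (proof:
`L²` difference inequality, Moser `H^m` inequality, Gagliardo–Nirenberg) run in PHYSICAL variables with the
Type-I budget `∫₀^{T₁−δ}‖∇(u,c)‖∞ ≤ C log(T₁/δ)`; symmetrising variables `(π, u, s)`, `π ∝ ρ^{1/3}`, symmetriser
a function of the transported entropy only (Makino–Ukai–Kawashima), so the unbounded `u, c` of the implosion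
enter only differentiated — the nonlinear, forced, physical-space twin of BCG arXiv:2208.09445 Lemma 7.12 /
Cor 7.13; EOS nonlinearity `c_σ(π) = σ⁻¹Φ(σπ)`, `Φ` analytic on the packing range; data non-isentropy
`s^σ − s₀ = O(σ³)` transported; Disproof §6–§7 bookkeeping `κ < qβ/C`).
**A-priori log-budget shadowing.** Fix the unbundled `HsEosLowDensity` data `(η₀, F)`, a Type-I reference
`(ρ₁,u₁,θ₁)` on `[0,T₁)` as produced by `stub_typeOneImplosion` (data `(β₀,u₀,θ₀)`, isentropic, Type-I
gradients, polynomial derivative bounds, polynomial no-vacuum bound) and a smooth positive data family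
`ρ₀^σ` with `‖ρ₀^σ − β₀‖_{Cⁿ} ≤ Cₙσ³` (`stub_smoothStatics`). Then for every packing target `η > 0` there are
an exit exponent `e > 0` and `σ₂ ∈ (0, σ₁]` such that for `0 < σ < σ₂`: `σ^e < T₁`, the data packing is
`≤ η`, and there is `M = M(σ)` such that EVERY classical hard-sphere–Euler solution `(ρ,u,θ)` with data
`(ρ₀^σ, u₀, θ₀)` on any `[0,T)` with `T ≤ T₁ − σ^e/2` satisfies, pointwise on `[0,T) × 𝕋³`, the state/C¹
bounds of `stub_conditionalExistence` with `(M, η)` AND the shadowing inequality `ρ₁ ≤ 2ρ`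
(bootstrap on `‖∇δV‖∞ ≤ C/(T₁−t)`: `‖δV‖_{L²} ≤ Cσ³(T₁−t)^{−b₀}`, `‖V_σ‖_{H^m} ≤ C(T₁−t)^{−b_m}`,
`‖δV‖_{C¹} ≤ Cσ^{3(1−ϑ)}(T₁−t)^{−b}`, closing for `T₁ − t ≥ σ^e/2` once `e < 3(1−ϑ)/(b+1)`; the packing
stays `≤ C σ^{3−eβ} → 0`, inside the analyticity range of `Z`). -/
theorem stub_logBudgetShadowing :
    ∀ η₀ : ℝ, 0 < η₀ → ∀ F : ℝ → ℝ, AnalyticOnNhd ℝ F (Ioo (-η₀) η₀) →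
      EqOn hsExcessFreeEnergy F (Ico 0 η₀) → F 0 = 0 → deriv F 0 = 2 * Real.pi / 3 →
    ∀ (β₀ θ₀ : T3 → ℝ) (u₀ : T3 → V3) (T₁ K : ℝ) (ρ₁ θ₁ : ℝ → T3 → ℝ) (u₁ : ℝ → T3 → V3),
      0 < T₁ → 0 < K → IsHardSphereEulerSolution 0 T₁ ρ₁ u₁ θ₁ →
      (∀ x, ρ₁ 0 x = β₀ x) → u₁ 0 = u₀ → θ₁ 0 = θ₀ →
      (∀ t ∈ Ico 0 T₁, ∀ x, θ₁ t x = K * ρ₁ t x ^ (2 / 3 : ℝ)) →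
      (∃ C : ℝ, ∀ t ∈ Ico 0 T₁, ∀ x, ∀ i : Fin 3,
          ‖Torus.partialDeriv i (u₁ t) x‖ ≤ C / (T₁ - t) ∧
          |Torus.partialDeriv i (fun y => ρ₁ t y ^ (1 / 3 : ℝ)) x| ≤ C / (T₁ - t)) →
      (∀ n : ℕ, n ≤ 6 → ∃ Cn pn : ℝ, ∀ t ∈ Ico 0 T₁, ∀ y : EuclideanSpace ℝ (Fin 3),
          ‖iteratedFDeriv ℝ n (Torus.lift (ρ₁ t)) y‖ ≤ Cn * (T₁ - t) ^ (-pn) ∧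
          ‖iteratedFDeriv ℝ n (Torus.lift (u₁ t)) y‖ ≤ Cn * (T₁ - t) ^ (-pn)) →
      (∃ cl pl : ℝ, 0 < cl ∧ ∀ t ∈ Ico 0 T₁, ∀ x, cl * (T₁ - t) ^ pl ≤ ρ₁ t x) →
    ∀ (ρs : ℝ → T3 → ℝ) (σ₁ : ℝ), 0 < σ₁ →
      (∀ σ : ℝ, 0 < σ → σ < σ₁ → Torus.IsSmooth (ρs σ) ∧ ∀ x, 0 < ρs σ x) →
      (∀ n : ℕ, ∃ Cn : ℝ, ∀ σ : ℝ, 0 < σ → σ < σ₁ → ∀ y : EuclideanSpace ℝ (Fin 3),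
          ‖iteratedFDeriv ℝ n (Torus.lift (fun x => ρs σ x - β₀ x)) y‖ ≤ Cn * σ ^ 3) →
    ∀ η : ℝ, 0 < η →
      ∃ e : ℝ, 0 < e ∧ ∃ σ₂ : ℝ, 0 < σ₂ ∧ σ₂ ≤ σ₁ ∧ ∀ σ : ℝ, 0 < σ → σ < σ₂ →
        σ ^ e < T₁ ∧ (∀ x, ρs σ x * σ ^ 3 ≤ η) ∧
        ∃ M : ℝ, 0 < M ∧ ∀ T : ℝ, T ≤ T₁ - σ ^ e / 2 → ∀ (ρ θ : ℝ → T3 → ℝ) (u : ℝ → T3 → V3),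
          IsHardSphereEulerSolution σ T ρ u θ → ρ 0 = ρs σ → u 0 = u₀ → θ 0 = θ₀ →
          ∀ t ∈ Ico 0 T, ∀ x,
            (M⁻¹ ≤ ρ t x ∧ ρ t x ≤ M ∧ M⁻¹ ≤ θ t x ∧ θ t x ≤ M ∧ ‖u t x‖ ≤ M ∧
              ρ t x * σ ^ 3 ≤ η ∧
              ∀ i : Fin 3, ‖Torus.partialDeriv i (u t) x‖ ≤ M ∧
                |Torus.partialDeriv i (ρ t) x| ≤ M ∧ |Torus.partialDeriv i (θ t) x| ≤ M) ∧
            ρ₁ t x ≤ 2 * ρ t x := by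
  exact Summit.AtomisticToContinuum.HydrodynamicLimit.Theorems.stub_logBudgetShadowing

/-! ## Stub E — the hard-sphere equation of state at low density (RESHAPE by the lead, cycle 2)

The crux-plan composition took the route support `HsEosLowDensity` (stmt-0768) as a hypothesis BY NAME. The lead
turns it into four registered stubs over the tree's canonical cluster machinery for the UNIFORM gas
(`uniformProfile`, `XiN`/`qN` insertion ratios of `HardSphereEulerRatio`, the cluster constants `bE` of
`HardSphereCanonicalTorus`, for which the cluster integrals are EXACT: `W_ε(j+1) = ε^{3j} bE j` once `jε < 1/4`,
`Wd_self_eq_pow_mul` with `β ≡ 1`), so that the composition below concludes the crux with NO hypothesis.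
Write `Φ(u) := ∑_j bE j · uʲ / j!` (radius `≥ 1/(e v₁)` by `abs_clusterCoeff_le`); the limit insertion ratio
`R(x)` at reduced density `x = ε³·m` solves `R · Φ(x R) = 1` (`ratioLimit_spec` for the uniform profile), i.e.
`R = 1/Φ(ψ⁻¹(x))` with `ψ(u) = u Φ(u)`, analytic near `0`, `R(0) = 1`, `R'(0) = −bE 1 = v₁ = 4π/3`; the excess
free energy is `F(η) = ∫₀¹ log R(ηs) ds` (telescoping `log Ξ_N(N+1) = −Σ_m log q_N(m)` + a Riemann sum), analytic
near `0` with `F(0) = 0`, `F'(0) = R'(0)/2 = 2π/3` (the second virial coefficient). -/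

/-- STUB E1 (LANDED p73064; size M–L; sources: tree `bE`, `abs_clusterCoeff_le` (⇒ `|bE j|/j! ≤ e (e v₁)ʲ`), `cE`/`uR` for two
points (`bE 1 = −v₁`), `v₁`, Mathlib `volume_ball_fin_three` (`v₁ = 4π/3`), `FormalMultilinearSeries.ofScalars`,
the analytic inverse function theorem `Mathlib/Analysis/Analytic/Inverse.lean` (local inverse of `ψ(u) = uΦ(u)`,
`ψ'(0) = 1`), `HasFPowerSeriesAt.comp`/`.inv`).
**The analytic insertion factor.** There are `r > 0` and `Rf : ℝ → ℝ` with a power series at `0` converging on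
the ball of radius `r`, `Rf 0 = 1`, `Rf′(0) = 4π/3`, solving `Rf x · Φ(x · Rf x) = 1` with `0 < Rf x` on `(−r, r)`,
`1 ≤ Rf x ≤ 2` and Lipschitz on `[0, r]`, and `Rf x` is the ONLY root of `R · Φ(xR) = 1` in `[1/2, 2]` for `|x| < r`. -/
theorem stub_eosRatioAnalytic :
    ∃ r : ℝ, 0 < r ∧ ∃ Rf : ℝ → ℝ,
      (∃ p : FormalMultilinearSeries ℝ ℝ ℝ, HasFPowerSeriesOnBall Rf p 0 (ENNReal.ofReal r)) ∧
      Rf 0 = 1 ∧ deriv Rf 0 = 4 * Real.pi / 3 ∧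
      (∀ x ∈ Ioo (-r) r, 0 < Rf x ∧
        Rf x * (∑' j : ℕ, bE j / (j.factorial : ℝ) * (x * Rf x) ^ j) = 1) ∧
      (∀ x ∈ Icc 0 r, 1 ≤ Rf x ∧ Rf x ≤ 2) ∧
      (∃ L : NNReal, LipschitzOnWith L Rf (Icc 0 r)) ∧
      (∀ x ∈ Ioo (-r) r, ∀ R ∈ Icc (1 / 2 : ℝ) 2,
        R * (∑' j : ℕ, bE j / (j.factorial : ℝ) * (x * R) ^ j) = 1 → R = Rf x) := by
  exact Summit.AtomisticToContinuum.HydrodynamicLimit.Theorems.stub_eosRatioAnalytic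

/-- STUB E2a (LANDED p74228 after helpers p73032, p73763; size L; sources: tree `HardSphereEulerRatio` — `XiN`, `qN`, `rN`, `inv_qN_eq_sum`
(`1/q_N(m) = Σ_{j≤m} C(m,j) W¹_N(j+1) r_N(m,j)`), `XiN_pos`, `one_le_qN`, `qN_le`, `rN_le`, `abs_coefN_le`,
`coefN_one_zero`; `HardSphereCanonicalTorus.Wd_eq_Wd_self` + `Wd_self_eq_pow_mul` with `uniformProfile`
(`β ≡ 1`, `Jint = bE`: the coefficients are EXACTLY `C(m,j) ε^{3j} bE j` for `jε < 1/4`), `uniformProfile_M`,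
`ovDensity_uniformProfile`, `succ_mul_hsDiameter_pow_three`; the tree's two-scale contraction
(`abs_inv_qN_sub_inv_le`, `eventually_abs_qN_sub_le_step`) is replaced by a ONE-PASS strong induction on the level
`m`, possible because for the uniform gas nothing is left to a non-quantitative limit: the consistency error
`|C(m,j) − mʲ/j!| ε^{3j} ≤ C_j x_m^{j−1} ε³` and the height drift `|x_{m−i} − x_m| = i ε³` are `O(ε³) = O(η/N)`
uniformly in `m`).
**Uniform convergence of the insertion ratios at all heights.** For every `Rf` solving `Rf x · Φ(x Rf x) = 1` with
`1 ≤ Rf ≤ 2` and Lipschitz on `[0, r]`, there is `η₂ ∈ (0, r]` such that for `0 < η < η₂` the insertion ratios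
`q_N(m) = Ξ_N(m)/Ξ_N(m+1)` of `N + 1` uniform hard spheres of diameter `ε_N = η^{1/3}(N+1)^{−1/3}` on `𝕋³` satisfy
`sup_{m ≤ N} |q_N(m) − Rf(η m/(N+1))| → 0` as `N → ∞`. -/
theorem stub_eosRatioUniform :
    ∀ (Rf : ℝ → ℝ) (r : ℝ), 0 < r →
      (∀ x ∈ Icc 0 r, 1 ≤ Rf x ∧ Rf x ≤ 2 ∧
        Rf x * (∑' j : ℕ, bE j / (j.factorial : ℝ) * (x * Rf x) ^ j) = 1) →
      (∃ L : NNReal, LipschitzOnWith L Rf (Icc 0 r)) →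
      ∃ η₂ : ℝ, 0 < η₂ ∧ η₂ ≤ r ∧ ∀ η ∈ Ioo 0 η₂, ∀ δ : ℝ, 0 < δ →
        ∀ᶠ N : ℕ in atTop, ∀ m : ℕ, m ≤ N →
          |qN uniformProfile (η ^ (1 / 3 : ℝ)) N m - Rf (η * m / (N + 1))| ≤ δ := by
  exact Summit.AtomisticToContinuum.HydrodynamicLimit.Theorems.stub_eosRatioUniform

/-- STUB E2b (LANDED p72929; size M–L; sources: tree `hsFreeVolume` (spheres of diameter `(η/N)^{1/3}`, STRICT non-overlap
`<`) vs `XiN uniformProfile (η^{1/3}) N (N+1)` = `volume (posDomain ε_N (N+1))` (non-strict `≤`; the difference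
`{dist = ε}` is a null set — `MeasureTheory.Measure.addHaar_sphere` through the chart), `Xi_zero`, `XiN_pos`,
`one_le_qN`, `qN_le` (`log q` is `1`-Lipschitz-comparable: `q, Rf ≥ 1`), telescoping `Ξ_N(N+1) = Π_{m≤N} q_N(m)⁻¹`,
Riemann sums of the continuous `s ↦ log Rf(ηs)` on `[0,1]`, `Filter.tendsto_add_atTop_iff_nat`; at `η = 0` the free
volume is `1` (diagonals are null), both sides are `0` — this is why `Rf 0 = 1` is a hypothesis; lead's fix, cycle 2).
**From insertion ratios to the free energy.** If the insertion ratios converge uniformly at all heights to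
`Rf(η m/(N+1))` (the conclusion of E2a, taken here as a hypothesis), then the canonical free energy per particle
converges: `−N⁻¹ log hsFreeVolume η N → ∫₀¹ log Rf(η s) ds`. -/
theorem stub_eosCesaro :
    ∀ (Rf : ℝ → ℝ) (r : ℝ), 0 < r → ContinuousOn Rf (Icc 0 r) → (∀ x ∈ Icc 0 r, 1 ≤ Rf x ∧ Rf x ≤ 2) →
      Rf 0 = 1 →
      ∀ η : ℝ, 0 ≤ η → η < r →
        (0 < η → ∀ δ : ℝ, 0 < δ → ∀ᶠ N : ℕ in atTop, ∀ m : ℕ, m ≤ N →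
          |qN uniformProfile (η ^ (1 / 3 : ℝ)) N m - Rf (η * m / (N + 1))| ≤ δ) →
        Tendsto (fun N : ℕ => -(N : ℝ)⁻¹ * Real.log (hsFreeVolume η N)) atTop
          (nhds (∫ s in (0 : ℝ)..1, Real.log (Rf (η * s)))) := by
  exact Summit.AtomisticToContinuum.HydrodynamicLimit.Theorems.stub_eosCesaro

/-- STUB E3 (LANDED p72629; size M–L; sources: Mathlib `HasFPowerSeriesOnBall` API (`.analyticAt_of_mem`, `AnalyticAt.log`-type
composition `Real.analyticAt_log`/`AnalyticAt.comp`, termwise integration of a power series in the parameter: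
`F(η) = ∫₀¹ g(ηs) ds = Σ_k a_k η^k/(k+1)` for `g = log ∘ Rf = Σ a_k η^k`, `intervalIntegral.integral_pow`,
`hasSum` interchange by dominated convergence / `intervalIntegral.hasSum_integral_of_dominated_convergence`),
`Filter.Tendsto.limsup_eq` (the limsup in `hsExcessFreeEnergy` is the limit), `deriv` of the power series at `0`).
**Assembly of `HsEosLowDensity`.** An analytic insertion factor `Rf` (power series at `0` of radius `≥ r`, `Rf 0 = 1`,
`Rf′(0) = 4π/3`, positive on `(−r, r)`) and the thermodynamic limit `−N⁻¹ log hsFreeVolume η N → ∫₀¹ log Rf(ηs) ds`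
for `η ∈ [0, η₂)` give the route support item `HsEosLowDensity` with `F(η) := ∫₀¹ log Rf(ηs) ds`:
`F` analytic on `(−η₀, η₀)`, `F = hsExcessFreeEnergy` on `[0, η₀)`, `F 0 = 0`, `F′(0) = 2π/3`, and the limit clause. -/
theorem stub_eosAssembly :
    ∀ (Rf : ℝ → ℝ) (r : ℝ), 0 < r →
      (∃ p : FormalMultilinearSeries ℝ ℝ ℝ, HasFPowerSeriesOnBall Rf p 0 (ENNReal.ofReal r)) →
      Rf 0 = 1 → deriv Rf 0 = 4 * Real.pi / 3 → (∀ x ∈ Ioo (-r) r, 0 < Rf x) →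
      ∀ η₂ : ℝ, 0 < η₂ → η₂ ≤ r →
        (∀ η ∈ Ico 0 η₂, Tendsto (fun N : ℕ => -(N : ℝ)⁻¹ * Real.log (hsFreeVolume η N)) atTop
          (nhds (∫ s in (0 : ℝ)..1, Real.log (Rf (η * s))))) →
        Summit.AtomisticToContinuum.HydrodynamicLimit.Theses.ImplosionDichotomy.HsEosLowDensity := by
  exact Summit.AtomisticToContinuum.HydrodynamicLimit.Theorems.stub_eosAssembly

/-- **The equation of state from the four E-stubs** (glue, proved): `HsEosLowDensity` (route support stmt-0768)
with NO hypothesis. -/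
theorem hsEosLowDensity_of_stubs :
    Summit.AtomisticToContinuum.HydrodynamicLimit.Theses.ImplosionDichotomy.HsEosLowDensity := by
  obtain ⟨r, hr, Rf, hps, h0, hd, hsol, hbd, hLip, -⟩ := stub_eosRatioAnalytic
  have hsol' : ∀ x ∈ Icc 0 (r / 2), 1 ≤ Rf x ∧ Rf x ≤ 2 ∧
      Rf x * (∑' j : ℕ, bE j / (j.factorial : ℝ) * (x * Rf x) ^ j) = 1 := by
    intro x hx
    have hx' : x ∈ Icc 0 r := ⟨hx.1, hx.2.trans (by linarith)⟩
    have hxo : x ∈ Ioo (-r) r := ⟨by linarith [hx.1], by linarith [hx.2]⟩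
    exact ⟨(hbd x hx').1, (hbd x hx').2, (hsol x hxo).2⟩
  have hLip' : ∃ L : NNReal, LipschitzOnWith L Rf (Icc 0 (r / 2)) := by
    obtain ⟨L, hL⟩ := hLip
    exact ⟨L, hL.mono (Icc_subset_Icc le_rfl (by linarith))⟩
  obtain ⟨η₂, hη₂, hη₂r, hunif⟩ := stub_eosRatioUniform Rf (r / 2) (by positivity) hsol' hLip'
  have hcont : ContinuousOn Rf (Icc 0 (r / 2)) := by
    obtain ⟨L, hL⟩ := hLip'
    exact hL.continuousOn
  have hbd' : ∀ x ∈ Icc 0 (r / 2), 1 ≤ Rf x ∧ Rf x ≤ 2 := fun x hx => ⟨(hsol' x hx).1, (hsol' x hx).2.1⟩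
  have hlim : ∀ η ∈ Ico 0 η₂, Tendsto (fun N : ℕ => -(N : ℝ)⁻¹ * Real.log (hsFreeVolume η N)) atTop
      (nhds (∫ s in (0 : ℝ)..1, Real.log (Rf (η * s)))) := by
    intro η hη
    refine stub_eosCesaro Rf (r / 2) (by positivity) hcont hbd' h0 η hη.1 (hη.2.trans_le hη₂r) ?_
    intro hηpos δ hδ
    exact hunif η ⟨hηpos, hη.2⟩ δ hδ
  exact stub_eosAssembly Rf r hr hps h0 hd (fun x hx => (hsol x hx).1) η₂ hη₂ (hη₂r.trans (by linarith)) hlim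

/-! ## Glue (proved): transporting the t = 0 law of large numbers to the solution's own fields -/

/-- The t = 0 LLN clause only sees the time-zero slices of the fields (Disproof §1,
`tendstoHydroFieldsAt_zero_iff`): if `(ρ, u, θ)(0) = (ρ₀, u₀, θ₀)` then the LLN towards the constant-in-time
fields `(ρ₀, u₀, θ₀)` at `t = 0` is the LLN towards `(ρ, u, θ)` at `t = 0`. [folklore] -/
theorem tendstoHydroFieldsAt_zero_of_data {ε : ℕ → ℝ}
    {P : (N : ℕ) → Measure (Literature.Analysis.FluidPDE.Config (N + 1) (Fin 3) T3)}
    {Φ : (N : ℕ) → Literature.Analysis.FluidPDE.HardSphereFlow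
      (Literature.Analysis.FluidPDE.Torus.geometry (Fin 3)) (ε N) (N + 1)}
    {ρ θ : ℝ → T3 → ℝ} {u : ℝ → T3 → V3} {ρ₀ θ₀ : T3 → ℝ} {u₀ : T3 → V3}
    (hρ : ρ 0 = ρ₀) (hu : u 0 = u₀) (hθ : θ 0 = θ₀)
    (h : TendstoHydroFieldsAt P Φ (fun _ => ρ₀) (fun _ => u₀) (fun _ => θ₀) 0) :
    TendstoHydroFieldsAt P Φ ρ u θ 0 := by
  unfold TendstoHydroFieldsAt at h ⊢
  intro χ hχ δ hδ
  obtain ⟨h1, h2, h3⟩ := h χ hχ δ hδ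
  refine ⟨?_, ?_, ?_⟩
  · simpa only [hρ] using h1
  · simpa only [hρ, hu] using h2
  · simpa only [hρ, hu, hθ] using h3

/-! ## The composition: the four stubs and the route support `HsEosLowDensity` give the crux BY NAME -/

/-- **`PolynomialCompression` from the line `log-lipschitz-budget`, given the equation of state.** Quantifier bookkeeping plus the
exponent algebra of Disproof §7: with the reference of `stub_typeOneImplosion` (core `≥ c(T₁−t)^{−β}`), the
statics family of `stub_smoothStatics`, the packing threshold `η₁` of `stub_conditionalExistence` and the exit
exponent `e` of `stub_logBudgetShadowing`, take `κ := eβ/2`; given `σ₀`, choose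
`σ := min(σ₀/2, σ₂/2, (min(c/2,1))^{2/(eβ)})`; existence on `[0, T₁ − σ^e/2)` from stubs 3+4, the LLN tie from
stub 2 transported by `tendstoHydroFieldsAt_zero_of_data`, and at the exit time `tₑ = T₁ − σ^e`:
`ρ tₑ x ≥ ρ₁ tₑ x / 2 ≥ (c/2) σ^{−eβ} ≥ σ^{−eβ/2}`. The only hypothesis is the route support item
`HsEosLowDensity` (stmt-AtomisticToContinuum-0768), by name. -/
theorem PolynomialCompression_of_eos
    (hZ : Summit.AtomisticToContinuum.HydrodynamicLimit.Theses.ImplosionDichotomy.HsEosLowDensity) :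
    Summit.AtomisticToContinuum.HydrodynamicLimit.Theses.ImplosionDichotomy.PolynomialCompression := by
  classical
  -- the equation of state (route support, by name)
  obtain ⟨η₀, hη₀, F, hF, hEq, hF0, hF', -⟩ := hZ
  -- the σ = 0 reference (stub 1)
  obtain ⟨a₀, θ₀, u₀, ha, hθ, hu, ha0, hθ0, T₁, K, ρ₁, θ₁, u₁, hT₁, hK, hsol₁, hρ₁0, hu₁0, hθ₁0,
    hisen, htypeI, hpoly, hlow, β, c, hβ, hc, hfloor⟩ := stub_typeOneImplosion
  -- quantitative statics (stub 2)
  obtain ⟨σ₁, hσ₁, ρs, hfam, hrate⟩ :=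
    stub_smoothStatics a₀ θ₀ u₀ ha hθ.continuous hu.continuous ha0 hθ0
  -- existence theory (stub 3)
  obtain ⟨η₁, hη₁, Hex⟩ := stub_conditionalExistence η₀ hη₀ F hF hEq hF0 hF'
  -- a-priori shadowing (stub 4), at the packing target η₁
  obtain ⟨e, he, σ₂, hσ₂, hσ₂₁, Hap⟩ :=
    stub_logBudgetShadowing η₀ hη₀ F hF hEq hF0 hF' (fun x => a₀ x / ∫ y, a₀ y) θ₀ u₀ T₁ K ρ₁ θ₁ u₁
      hT₁ hK hsol₁ hρ₁0 hu₁0 hθ₁0 hisen htypeI hpoly hlow ρs σ₁ hσ₁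
      (fun σ hσ hσ' => ⟨(hfam σ hσ hσ').1, (hfam σ hσ hσ').2.1⟩) hrate η₁ hη₁
  -- the witness: κ := e β / 2 and the reference profiles
  refine ⟨e * β / 2, by positivity, a₀, θ₀, u₀, ha.continuous, hθ.continuous, hu.continuous, ha0, hθ0, ?_⟩
  intro σ₀ hσ₀
  -- smallness threshold for the exponent bookkeeping
  have he' : e ≠ 0 := he.ne'
  have hβ' : β ≠ 0 := hβ.ne'
  set m : ℝ := min (c / 2) 1 with hm
  have hm0 : 0 < m := lt_min (by positivity) one_pos
  have hmc : m ≤ c / 2 := min_le_left _ _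
  set σ₃ : ℝ := m ^ (2 / (e * β)) with hσ₃
  have hσ₃0 : 0 < σ₃ := Real.rpow_pos_of_pos hm0 _
  set σ : ℝ := min (σ₀ / 2) (min (σ₂ / 2) σ₃) with hσdef
  have hσ0 : 0 < σ := lt_min (by positivity) (lt_min (by positivity) hσ₃0)
  have hσσ₀ : σ < σ₀ := (min_le_left _ _).trans_lt (by linarith)
  have hσσ₂ : σ < σ₂ := ((min_le_right _ _).trans (min_le_left _ _)).trans_lt (by linarith)
  have hσσ₃ : σ ≤ σ₃ := (min_le_right _ _).trans (min_le_right _ _)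
  have hσσ₁ : σ < σ₁ := hσσ₂.trans_le hσ₂₁
  refine ⟨σ, hσ0, hσσ₀, ?_⟩
  obtain ⟨hσT, hpack, M, hM, Hbnd⟩ := Hap σ hσ0 hσσ₂
  have hδ : 0 < σ ^ e := Real.rpow_pos_of_pos hσ0 e
  -- the horizon of classical existence
  set T' : ℝ := T₁ - σ ^ e / 2 with hT'
  have hT'pos : 0 < T' := by rw [hT']; linarith
  obtain ⟨hsm, hpos, hLLN⟩ := hfam σ hσ0 hσσ₁
  obtain ⟨ρ, θ, u, hsol, hρ0, hu0, hθ0'⟩ :=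
    Hex σ hσ0 (ρs σ) θ₀ u₀ hsm hθ hu hpos hθ0 hpack T' M hT'pos hM
      (fun T hT ρ θ u hs h1 h2 h3 t ht x => (Hbnd T hT ρ θ u hs h1 h2 h3 t ht x).1)
  refine ⟨T', ρ, θ, u, hsol, ?_, ?_⟩
  · -- admissibility: the t = 0 LLN tie (stub 2), transported to the solution's own fields
    intro Φ
    exact tendstoHydroFieldsAt_zero_of_data hρ0 hu0 hθ0' (hLLN Φ)
  · -- compression at the exit time tₑ := T₁ - σ ^ e
    set tₑ : ℝ := T₁ - σ ^ e with htₑ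
    have htₑ0 : 0 ≤ tₑ := by rw [htₑ]; linarith
    have htₑT : tₑ < T' := by rw [htₑ, hT']; linarith
    have htₑ1 : tₑ ∈ Ico 0 T₁ := ⟨htₑ0, by rw [htₑ]; linarith⟩
    obtain ⟨x, hx⟩ := hfloor tₑ htₑ1
    refine ⟨tₑ, ⟨htₑ0, htₑT⟩, x, ?_⟩
    have hclose : ρ₁ tₑ x ≤ 2 * ρ tₑ x :=
      (Hbnd T' le_rfl ρ θ u hsol hρ0 hu0 hθ0' tₑ ⟨htₑ0, htₑT⟩ x).2
    -- the reference floor at the exit time: c * σ ^ (e * -β) ≤ ρ₁ tₑ x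
    have hTt : T₁ - tₑ = σ ^ e := by rw [htₑ]; ring
    rw [hTt, ← Real.rpow_mul hσ0.le] at hx
    -- smallness: σ ^ (e β / 2) ≤ c / 2
    have hsmall : σ ^ (e * β / 2) ≤ c / 2 := by
      have h1 : σ ^ (e * β / 2) ≤ σ₃ ^ (e * β / 2) :=
        Real.rpow_le_rpow hσ0.le hσσ₃ (by positivity)
      have h2 : σ₃ ^ (e * β / 2) = m := by
        rw [hσ₃, ← Real.rpow_mul hm0.le]
        have : 2 / (e * β) * (e * β / 2) = 1 := by field_simp
        rw [this, Real.rpow_one]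
      exact (h1.trans_eq h2).trans hmc
    -- exponent algebra
    have hA : 0 < σ ^ (-(e * β / 2)) := Real.rpow_pos_of_pos hσ0 _
    have hAA : σ ^ (e * -β) = σ ^ (-(e * β / 2)) * σ ^ (-(e * β / 2)) := by
      rw [← Real.rpow_add hσ0]; congr 1; ring
    have hinv : σ ^ (e * β / 2) = (σ ^ (-(e * β / 2)))⁻¹ := by
      rw [Real.rpow_neg hσ0.le, inv_inv]
    have h1 : 1 ≤ c / 2 * σ ^ (-(e * β / 2)) := by
      rw [hinv] at hsmall
      have := mul_le_mul_of_nonneg_right hsmall hA.le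
      rwa [inv_mul_cancel₀ hA.ne'] at this
    calc σ ^ (-(e * β / 2)) = 1 * σ ^ (-(e * β / 2)) := (one_mul _).symm
      _ ≤ (c / 2 * σ ^ (-(e * β / 2))) * σ ^ (-(e * β / 2)) :=
          mul_le_mul_of_nonneg_right h1 hA.le
      _ = c * σ ^ (e * -β) / 2 := by rw [hAA]; ring
      _ ≤ ρ₁ tₑ x / 2 := by linarith
      _ ≤ ρ tₑ x := by linarith

/-- **The skeleton concludes the crux BY NAME, unconditionally**: `PolynomialCompression` (route
`ImplosionDichotomy`, stmt-AtomisticToContinuum-12587) from the registered stubs — the equation of state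
`HsEosLowDensity` is now supplied by the E-stubs (`hsEosLowDensity_of_stubs`) instead of being a hypothesis. -/
theorem PolynomialCompression_of :
    Summit.AtomisticToContinuum.HydrodynamicLimit.Theses.ImplosionDichotomy.PolynomialCompression :=
  PolynomialCompression_of_eos hsEosLowDensity_of_stubs

end Summit.AtomisticToContinuum.HydrodynamicLimit.Cruxes.PolynomialCompression.LogLipschitzBudget
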